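import Summits.AtomisticToContinuum.BoseEinsteinCondensation.Theses.BECConjugateDomination
import Summits.AtomisticToContinuum.BoseEinsteinCondensation.Theorems.BECConjugateDominationPositiveMinimiserRegularity
import Summits.AtomisticToContinuum.BoseEinsteinCondensation.Theorems.BECConjugateDominationPositiveMinimiserTorusGS2
import HarnessLib

/-!
# Route `BECConjugateDomination`, support item `PositiveMinimiser` (stmt-AtomisticToContinuum-11787):
# the periodic `N`-body energy has a `C³`, finite-energy, strictly positive minimiser

Closing file. For a pair potential `v` of the smooth class (repulsive finite range, finite, `C²`
as `x ↦ v(|x|)` on `ℝ³`; the edge condition is not used), every `N = n + 1 ≥ 1` and `L > 0`: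

1. (**the potential on the torus**, first part of this file) near every point the lattice sum
   `v^per(x) = ∑_{n ∈ ℤ³} v(|x - Ln|)` is a finite sum (finite range), so `x ↦ v^per(x).toReal` is
   `C²` (`contDiff_toReal_periodizedPotential`), `v^per ≤ C` (`exists_periodizedPotential_le`,
   continuity + periodicity), and `W = (∑_{i<j} v^per(xᵢ - xⱼ)).toReal` is `C²`, periodic and
   Lipschitz;
2. the torus Feynman–Kac ground state `Ψ₀ > 0` exists: continuous, periodic, Bose symmetric,
   cell-normalised, `e^{-tH}Ψ₀ = e^{-λt}Ψ₀` pointwise, `periodicGroundStateEnergy = λ`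
   (`exists_torus_groundState`);
3. `Ψ₀ ∈ C³` (`contDiff_of_eigen`: Duhamel identity for the free heat operator and the Gaussian
   one-derivative gain, bootstrapped `C⁰ → C¹ → C² → C³`);
4. the real `C³` function `Ψ₀`, read as a complex periodic trial state, has
   `periodicEnergy = ∫_cell|∇Ψ₀|² + ∫_cell W Ψ₀² ≤ λ` (`realEnergy_le_ofReal_of_eigen`: Fatou bound of
   the kinetic energy by the free small-time form and the eigen-relation), hence
   `= periodicGroundStateEnergy` by the variational principle; it is finite, `C³`, equal to its
   modulus and nowhere zero.

`PositiveMinimiser_proof : PositiveMinimiser` closes the item. [folklore] (Reed–Simon IV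
Thm XIII.44/XIII.47; Chung–Zhao (1995) Thms 3.17, 3.27; regularity via the free heat kernel.)
-/

noncomputable section

namespace Summit.AtomisticToContinuum.BoseEinsteinCondensation.Theorems.PositiveMinimiser

open MeasureTheory ProbabilityTheory Filter Set Metric
open scoped ENNReal NNReal Topology
open Literature.MathematicalPhysics.QuantumManyBody.BoseGas

section Potential

variable {N : ℕ} {v : ℝ → ℝ≥0∞} {L : ℝ}


/-! ### Local finiteness of the lattice sum -/

/-- **The lattice points near a given point are finite**: `{n : |x₀ - Ln| ≤ R}` is finite
(`L > 0`; each coordinate of `n` is bounded by `(‖x₀‖ + R)/L`). [folklore] -/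
theorem finite_latticeVec_near (hL : 0 < L) (x₀ : Space) (R : ℝ) :
    {n : Fin 3 → ℤ | ‖x₀ - latticeVec L n‖ ≤ R}.Finite := by
  set B : ℤ := ⌈(‖x₀‖ + R) / L⌉ with hB
  refine (Set.Finite.pi (t := fun _ : Fin 3 => Set.Icc (-B) B) fun _ => Set.finite_Icc _ _).subset ?_
  intro n hn
  simp only [Set.mem_setOf_eq] at hn
  simp only [Set.mem_pi, Set.mem_univ, Set.mem_Icc, forall_true_left]
  intro k
  have hk : |(x₀ - latticeVec L n) k| ≤ R := (abs_coord_le_norm (N := 1) (fun _ => x₀ - latticeVec L n) 0 k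
    |>.trans (by rw [Pi.norm_def]; simp)).trans hn
  have hk' : |L * n k| ≤ ‖x₀‖ + R := by
    have h1 : |x₀ k| ≤ ‖x₀‖ := by
      have := abs_coord_le_norm (N := 1) (fun _ => x₀) 0 k
      rwa [show ‖(fun _ : Fin 1 => x₀)‖ = ‖x₀‖ by rw [Pi.norm_def]; simp] at this
    have h2 : (x₀ - latticeVec L n) k = x₀ k - L * n k := by
      simp [latticeVec]
    rw [h2] at hk
    have := abs_sub_abs_le_abs_sub (L * n k) (x₀ k)
    rw [abs_sub_comm] at this
    linarith
  have hnk : |(n k : ℝ)| ≤ (‖x₀‖ + R) / L := by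
    rw [le_div_iff₀ hL, mul_comm]
    rwa [abs_mul, abs_of_pos hL] at hk'
  have hceil : (|(n k : ℝ)|) ≤ (B : ℝ) := hnk.trans (Int.le_ceil _)
  have hab := abs_le.1 hceil
  constructor <;> [skip; skip]
  · have : (-(B : ℝ)) ≤ (n k : ℝ) := hab.1
    exact_mod_cast this
  · have : (n k : ℝ) ≤ (B : ℝ) := hab.2
    exact_mod_cast this

/-- **Near every point the periodisation is a finite sum** (finite range `v = 0` on `(R₀, ∞)`,
`L > 0`): with `S = {n : |x₀ - Ln| ≤ R₀ + 1}`, for `x ∈ ball x₀ 1`,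
`v^per(x) = ∑_{n ∈ S} v(|x - Ln|)`. [folklore] -/
theorem periodizedPotential_eq_finset_sum_of_mem_ball (hL : 0 < L) {R₀ : ℝ}
    (hR : ∀ r, R₀ < r → v r = 0) (x₀ : Space) {x : Space} (hx : x ∈ ball x₀ 1) :
    periodizedPotential v L x =
      ∑ n ∈ (finite_latticeVec_near hL x₀ (R₀ + 1)).toFinset, v ‖x - latticeVec L n‖ := by
  unfold periodizedPotential
  refine tsum_eq_sum fun n hn => ?_
  rw [Set.Finite.mem_toFinset, Set.mem_setOf_eq, not_le] at hn
  apply hR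
  have h1 : ‖x₀ - latticeVec L n‖ ≤ ‖x₀ - x‖ + ‖x - latticeVec L n‖ := norm_sub_le_norm_sub_add_norm_sub _ _ _
  have h2 : ‖x₀ - x‖ < 1 := by rw [← dist_eq_norm, dist_comm]; exact hx
  linarith

/-- The periodisation of a finite, finite-range potential is finite everywhere (`L > 0`). [folklore] -/
theorem periodizedPotential_ne_top (hL : 0 < L) {R₀ : ℝ} (hR : ∀ r, R₀ < r → v r = 0)
    (hfin : ∀ r, v r ≠ ⊤) (x : Space) : periodizedPotential v L x ≠ ⊤ := by
  rw [periodizedPotential_eq_finset_sum_of_mem_ball hL hR x (mem_ball_self one_pos)]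
  exact ENNReal.sum_ne_top.2 fun n _ => hfin _

/-- **Real form of the periodisation near a point**: for `x ∈ ball x₀ 1`,
`v^per(x).toReal = ∑_{n ∈ S(x₀)} ṽ(x - Ln)` with `ṽ(y) = v(|y|).toReal`. [folklore] -/
theorem toReal_periodizedPotential_eq_of_mem_ball (hL : 0 < L) {R₀ : ℝ}
    (hR : ∀ r, R₀ < r → v r = 0) (hfin : ∀ r, v r ≠ ⊤) (x₀ : Space) {x : Space} (hx : x ∈ ball x₀ 1) :
    (periodizedPotential v L x).toReal =
      ∑ n ∈ (finite_latticeVec_near hL x₀ (R₀ + 1)).toFinset, (v ‖x - latticeVec L n‖).toReal := by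
  rw [periodizedPotential_eq_finset_sum_of_mem_ball hL hR x₀ hx, ENNReal.toReal_sum fun n _ => hfin _]

/-! ### `C²` regularity -/

/-- **The real periodisation `x ↦ v^per(x).toReal` is `C^k` when `ṽ(y) = v(|y|).toReal` is** (finite
range, finite, `L > 0`): locally a finite sum of translates of `ṽ`. [folklore] -/
theorem contDiff_toReal_periodizedPotential (hL : 0 < L) {R₀ : ℝ} (hR : ∀ r, R₀ < r → v r = 0)
    (hfin : ∀ r, v r ≠ ⊤) {k : WithTop ℕ∞} (hv : ContDiff ℝ k fun y : Space => (v ‖y‖).toReal) :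
    ContDiff ℝ k fun x : Space => (periodizedPotential v L x).toReal := by
  refine contDiff_iff_contDiffAt.2 fun x₀ => ?_
  have hloc : (fun x : Space => (periodizedPotential v L x).toReal) =ᶠ[𝓝 x₀]
      fun x => ∑ n ∈ (finite_latticeVec_near hL x₀ (R₀ + 1)).toFinset, (v ‖x - latticeVec L n‖).toReal := by
    filter_upwards [ball_mem_nhds x₀ one_pos] with x hx
    exact toReal_periodizedPotential_eq_of_mem_ball hL hR hfin x₀ hx
  refine ContDiffAt.congr_of_eventuallyEq ?_ hloc
  refine ContDiff.contDiffAt ?_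
  refine ContDiff.sum fun n _ => ?_
  exact hv.comp (contDiff_id.sub contDiff_const)

/-- **The real periodic interaction `W = (∑_{i<j} v^per(xᵢ - xⱼ)).toReal` is `C^k` when `ṽ` is**
(finite range, finite, `L > 0`). [folklore] -/
theorem contDiff_toReal_periodicInteraction (hL : 0 < L) {R₀ : ℝ} (hR : ∀ r, R₀ < r → v r = 0)
    (hfin : ∀ r, v r ≠ ⊤) {k : WithTop ℕ∞} (hv : ContDiff ℝ k fun y : Space => (v ‖y‖).toReal) :
    ContDiff ℝ k fun X : Config N => (periodicInteraction v L X).toReal := by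
  have h1 : (fun X : Config N => (periodicInteraction v L X).toReal) =
      fun X => ∑ i : Fin N, ∑ j ∈ Finset.univ.filter (fun j => i < j),
        (periodizedPotential v L (X i - X j)).toReal := by
    funext X
    unfold periodicInteraction
    rw [ENNReal.toReal_sum fun _ _ => ENNReal.sum_ne_top.2 fun _ _ => periodizedPotential_ne_top hL hR hfin _]
    refine Finset.sum_congr rfl fun i _ => ?_
    rw [ENNReal.toReal_sum fun _ _ => periodizedPotential_ne_top hL hR hfin _]
  rw [h1]
  refine ContDiff.sum fun i _ => ContDiff.sum fun j _ => ?_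
  have hlin : ContDiff ℝ k fun X : Config N => X i - X j :=
    (ContinuousLinearMap.proj (R := ℝ) (φ := fun _ : Fin N => Space) i).contDiff.sub
      (ContinuousLinearMap.proj (R := ℝ) (φ := fun _ : Fin N => Space) j).contDiff
  exact (contDiff_toReal_periodizedPotential hL hR hfin hv).comp hlin

/-! ### Periodicity and boundedness -/

/-- **`W` is periodic in every particle.** [folklore] -/
theorem toReal_periodicInteraction_periodic (v : ℝ → ℝ≥0∞) (L : ℝ) (X : Config N) (i : Fin N)
    (c : Fin 3) :
    (periodicInteraction v L (X + Pi.single i (EuclideanSpace.single c L))).toReal =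
      (periodicInteraction v L X).toReal := by
  rw [periodicInteraction_add_single]

/-- A generator of the period lattice is a lattice vector: `L e_c = L · δ_c`. [folklore] -/
theorem single_eq_latticeVec (L : ℝ) (c : Fin 3) :
    EuclideanSpace.single c L = latticeVec L (Pi.single c 1) := by
  ext k
  rw [show latticeVec L (Pi.single c 1) k = L * ((Pi.single c (1 : ℤ) : Fin 3 → ℤ) k : ℝ) from rfl,
    PiLp.single_apply]
  by_cases h : k = c
  · subst h; simp
  · simp [h]

/-- **The periodisation of a smooth-class potential is bounded**: `v^per ≤ C` for some `C : ℝ≥0`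
(`x ↦ v^per(x).toReal` is continuous and `Lℤ³`-periodic; read it on `Config 1` and use the tree's
bound for continuous periodic functions). [folklore] -/
theorem exists_periodizedPotential_le (hL : 0 < L) {R₀ : ℝ} (hR : ∀ r, R₀ < r → v r = 0)
    (hfin : ∀ r, v r ≠ ⊤) (hv : Continuous fun y : Space => (v ‖y‖).toReal) :
    ∃ C : ℝ≥0, ∀ x, periodizedPotential v L x ≤ C := by
  have hc : ContDiff ℝ 0 fun y : Space => (v ‖y‖).toReal := contDiff_zero.2 hv
  have hWc : Continuous fun x : Space => (periodizedPotential v L x).toReal :=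
    (contDiff_toReal_periodizedPotential hL hR hfin hc).continuous
  set f : Config 1 → ℝ := fun X => (periodizedPotential v L (X 0)).toReal with hf
  have hfc : Continuous f := hWc.comp (continuous_apply 0)
  have hfper : ∀ (X : Config 1) (i : Fin 1) (k : Fin 3),
      f (X + Pi.single i (EuclideanSpace.single k L)) = f X := by
    intro X i k
    have hi : i = 0 := Subsingleton.elim _ _
    subst hi
    simp only [hf, Pi.add_apply, Pi.single_eq_same, single_eq_latticeVec, periodizedPotential_add_latticeVec]
  obtain ⟨M, hM0, hM⟩ := exists_bound_of_continuous_periodic hL hfc hfper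
  refine ⟨M.toNNReal, fun x => ?_⟩
  have h1 : (periodizedPotential v L x).toReal ≤ M := by
    have := hM (fun _ => x)
    simp only [hf] at this
    exact (le_abs_self _).trans this
  rw [← ENNReal.ofReal_toReal (periodizedPotential_ne_top hL hR hfin x), ENNReal.ofReal]
  exact ENNReal.coe_le_coe.2 (Real.toNNReal_le_toNNReal h1)

/-- **`W` is Lipschitz** for a smooth-class potential (`C¹` suffices; periodic with continuous
gradient). [folklore] -/
theorem exists_lipschitz_toReal_periodicInteraction (hL : 0 < L) {R₀ : ℝ} (hR : ∀ r, R₀ < r → v r = 0)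
    (hfin : ∀ r, v r ≠ ⊤) (hv : ContDiff ℝ 1 fun y : Space => (v ‖y‖).toReal) :
    ∃ G : ℝ, 0 ≤ G ∧ ∀ Y Z : Config N,
      |(periodicInteraction v L Y).toReal - (periodicInteraction v L Z).toReal| ≤ G * ‖Y - Z‖ :=
  exists_lipschitz_of_contDiff_periodic hL (contDiff_toReal_periodicInteraction hL hR hfin hv)
    (toReal_periodicInteraction_periodic v L)

end Potential

/-! ### The minimiser -/

variable {N : ℕ} {v : ℝ → ℝ≥0∞} {L : ℝ} {C : ℝ≥0}

/-- **The energy of a `C¹` Feynman–Kac eigenfunction is at most its eigenvalue**: for a continuous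
periodic nonnegative cell-normalised `Ψ₀ ∈ C¹` with `e^{-λt} ≤ ⟨Ψ₀, e^{-tH}Ψ₀⟩_cell` (`t > 0`),
`∫_cell |∇Ψ₀|² + ∫_cell Ψ₀² V^per ≤ λ` (Fatou for the kinetic term against the eventual bound of
the free small-time form, and the potential bound). [folklore] -/
theorem realEnergy_le_ofReal_of_eigen (hv : Measurable v) (hL : 0 < L)
    (hC : ∀ x, periodizedPotential v L x ≤ C) {Ψ₀ : Config N → ℝ} (hC1 : ContDiff ℝ 1 Ψ₀)
    (hper : ∀ (X : Config N) (i : Fin N) (k : Fin 3),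
      Ψ₀ (X + Pi.single i (EuclideanSpace.single k L)) = Ψ₀ X)
    (hnn : ∀ X, 0 ≤ Ψ₀ X) (hnorm : ∫ X in cellN N L, Ψ₀ X ^ 2 = 1) {lam : ℝ}
    (heig : ∀ t : ℝ, 0 < t → Real.exp (-(lam * t)) ≤ ∫ X in cellN N L, Ψ₀ X * pfkReal v L t Ψ₀ X) :
    (∫⁻ X in cellN N L, realKinetic Ψ₀ X) +
        ∫⁻ X in cellN N L, ENNReal.ofReal (Ψ₀ X ^ 2) * periodicInteraction v L X ≤ ENNReal.ofReal lam := by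
  have hcont : Continuous Ψ₀ := hC1.continuous
  obtain ⟨M, -, hM⟩ := exists_bound_of_continuous_periodic hL hcont hper
  have hsq : Integrable (fun X => Ψ₀ X ^ 2) (volume.restrict (cellN N L)) :=
    (memLp_two_cellN_of_bound L hcont.measurable hM).integrable_sq
  set Pot : ℝ := ∫ X in cellN N L, Ψ₀ X ^ 2 * (periodicInteraction v L X).toReal with hPotdef
  have hPot0 : 0 ≤ Pot := integral_nonneg fun X => mul_nonneg (sq_nonneg _) ENNReal.toReal_nonneg
  have hPotle : Pot ≤ lam := setIntegral_cellN_sq_mul_periodicInteraction_le hv hL hC hcont hper hnn hnorm heig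
  have hPotL : ∫⁻ X in cellN N L, ENNReal.ofReal (Ψ₀ X ^ 2) * periodicInteraction v L X = ENNReal.ofReal Pot :=
    setLIntegral_cellN_sq_mul_periodicInteraction_eq_ofReal hv hC hcont.measurable hsq
  -- the kinetic term: Fatou against the eventual bound, for every `K' > λ - Pot`
  have hKin : ∀ K' : ℝ, lam - Pot < K' → ∫⁻ X in cellN N L, realKinetic Ψ₀ X ≤ ENNReal.ofReal K' := by
    intro K' hK'
    have hev := sqIncrCell_div_eventually_le hv hL hC hcont hper hnn hnorm heig hK'
    calc ∫⁻ X in cellN N L, realKinetic Ψ₀ X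
        ≤ liminf (fun t : ℝ≥0 => (ENNReal.ofReal (2 * t))⁻¹ * sqIncrCell L t Ψ₀) (𝓝[>] 0) :=
          kinetic_le_liminf_sqIncrCell L hC1
      _ ≤ liminf (fun _ : ℝ≥0 => ENNReal.ofReal K') (𝓝[>] 0) := liminf_le_liminf hev
      _ = ENNReal.ofReal K' := liminf_const _
  have hKin' : ∫⁻ X in cellN N L, realKinetic Ψ₀ X ≤ ENNReal.ofReal (lam - Pot) := by
    refine ENNReal.le_of_forall_pos_le_add fun ε hε _ => ?_
    have h := hKin (lam - Pot + ε) (by simp [hε])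
    rwa [ENNReal.ofReal_add (by linarith) (by exact_mod_cast hε.le), ENNReal.ofReal_coe_nnreal] at h
  calc (∫⁻ X in cellN N L, realKinetic Ψ₀ X) +
        ∫⁻ X in cellN N L, ENNReal.ofReal (Ψ₀ X ^ 2) * periodicInteraction v L X
      ≤ ENNReal.ofReal (lam - Pot) + ENNReal.ofReal Pot := by rw [hPotL]; exact add_le_add hKin' le_rfl
    _ = ENNReal.ofReal lam := by rw [← ENNReal.ofReal_add (by linarith) hPot0]; congr 1; ring

/-- **`PositiveMinimiser` (item stmt-AtomisticToContinuum-11787 of route `BECConjugateDomination`).**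
For every smooth-class pair potential `v`, every `N = n + 1` and `L > 0`, the periodic `N`-body
energy has a minimiser in the periodic `C¹` Bose class which is `C³`, has finite energy, equals its
modulus and vanishes nowhere: the torus Feynman–Kac ground state. [folklore] -/
theorem positiveMinimiser_proof :
    Summit.AtomisticToContinuum.BoseEinsteinCondensation.Theses.BECConjugateDomination.PositiveMinimiser := by
  intro v hv hfin hC2 _ n L hL
  obtain ⟨hvm, R₀, hR⟩ := hv
  -- the potential
  obtain ⟨C, hC⟩ := exists_periodizedPotential_le hL hR hfin hC2.continuous
  have hW2 : ContDiff ℝ 2 (fun X : Config (n + 1) => (periodicInteraction v L X).toReal) :=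
    contDiff_toReal_periodicInteraction hL hR hfin hC2
  obtain ⟨G, hG, hlip⟩ := exists_lipschitz_toReal_periodicInteraction (N := n + 1) hL hR hfin
    (hC2.of_le (by norm_num))
  -- the Feynman–Kac ground state
  obtain ⟨Ψ₀, lam, -, hcont, hpos, hper, hsymm, hnormL, hnormR, heig, hE⟩ :=
    exists_torus_groundState (N := n + 1) hvm hL hC
  have hnn : ∀ X, 0 ≤ Ψ₀ X := fun X => (hpos X).le
  -- regularity
  have hC3 : ContDiff ℝ 3 Ψ₀ := by
    have h := contDiff_of_eigen hvm hL hC hG hlip (k := 2) hW2 (toReal_periodicInteraction_periodic v L)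
      hcont hper heig
    exact_mod_cast h
  have hC1 : ContDiff ℝ 1 Ψ₀ := hC3.of_le (by norm_num)
  -- the trial state
  have hψC : ContDiff ℝ 3 fun X : Config (n + 1) => ((Ψ₀ X : ℝ) : ℂ) := Complex.ofRealCLM.contDiff.comp hC3
  let Ψ : PeriodicTrialState (n + 1) L :=
    { ψ := fun X => ((Ψ₀ X : ℝ) : ℂ)
      contDiff := hψC.of_le (by norm_num)
      periodic := fun X i k => by simp only [hper]
      symm := fun σ X => by simp only [hsymm]
      norm_eq := by
        have : (fun X : Config (n + 1) => ((‖((Ψ₀ X : ℝ) : ℂ)‖₊ : ℝ≥0∞)) ^ 2) =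
            fun X => ENNReal.ofReal (Ψ₀ X) ^ 2 := by
          funext X; rw [ennnorm_sq_ofReal_periodic, ENNReal.ofReal_pow (hnn X)]
        rw [this, hnormL] }
  -- the energy
  have heig' : ∀ t : ℝ, 0 < t → Real.exp (-(lam * t)) ≤ ∫ X in cellN (n + 1) L, Ψ₀ X * pfkReal v L t Ψ₀ X := by
    intro t ht
    have : (fun X => Ψ₀ X * pfkReal v L t Ψ₀ X) = fun X => Real.exp (-(lam * t)) * Ψ₀ X ^ 2 := by
      funext X; rw [heig t ht X]; ring
    rw [this, integral_const_mul, hnormR, mul_one]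
  have hEΨ : periodicEnergy v Ψ = (∫⁻ X in cellN (n + 1) L, realKinetic Ψ₀ X) +
      ∫⁻ X in cellN (n + 1) L, ENNReal.ofReal (Ψ₀ X ^ 2) * periodicInteraction v L X := by
    have h := periodicEnergy_of_ofReal_mul Ψ (c := 1) hC1 (funext fun X => by simp [Ψ]) v
    rw [h, one_pow, ENNReal.ofReal_one, one_mul]
  have hle : periodicEnergy v Ψ ≤ ENNReal.ofReal lam := by
    rw [hEΨ]; exact realEnergy_le_ofReal_of_eigen hvm hL hC hC1 hper hnn hnormR heig'
  have heq : periodicEnergy v Ψ = periodicGroundStateEnergy v (n + 1) L :=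
    le_antisymm (hle.trans (le_of_eq hE.symm)) (periodicGroundStateEnergy_le v Ψ)
  refine ⟨Ψ, heq, ?_, hψC, fun X => ?_, fun X => ?_⟩
  · rw [heq, hE]; exact ENNReal.ofReal_ne_top
  · show ((Ψ₀ X : ℝ) : ℂ) = ((‖((Ψ₀ X : ℝ) : ℂ)‖ : ℝ) : ℂ)
    rw [Complex.norm_real, Real.norm_eq_abs, abs_of_pos (hpos X)]
  · show ((Ψ₀ X : ℝ) : ℂ) ≠ 0
    exact Complex.ofReal_ne_zero.2 (hpos X).ne'

end Summit.AtomisticToContinuum.BoseEinsteinCondensation.Theorems.PositiveMinimiser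

/-- **`PositiveMinimiser` holds** (item stmt-AtomisticToContinuum-11787): the route decl, by name.
[folklore] -/
theorem Summit.AtomisticToContinuum.BoseEinsteinCondensation.Theorems.PositiveMinimiser_proof :
    Summit.AtomisticToContinuum.BoseEinsteinCondensation.Theses.BECConjugateDomination.PositiveMinimiser :=
  Summit.AtomisticToContinuum.BoseEinsteinCondensation.Theorems.PositiveMinimiser.positiveMinimiser_proof

end
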